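import Summits.ABC.StewartYu.PadicG3PackClosed
import HarnessLib

/-!
# Cell abc-stewartyu, crux `Y07Odd` (stmt-ABC-19658), line `gen3-slab-odd`: the Kummer half-step record package from ONE INEQUALITY — closed
# forms for `c`, `D`, `Mh` filled in from `PadicG3SupplyHalf`

`Summits/ABC/StewartYu/PadicG3PackClosedHalf.lean` — sequel to `PadicG3PackClosed` (cell `abc-stewartyu`, seat p2-g4, F-odd lead; for p1 g7/g8).
Definitions (`DC`, `MhC`) and one theorem on `G3Setup`; no named fact.

* `DC L H s₁ τ = ν(H)^{t₀} · |b_{j₀}|^{|t|} · monDen(α, 2L|s₁|)`, `MhC = 2^{t₀} · M0C(L₀, H, Ŝ, lev+1, s₁, t₀) · XbC^{|t|} · monDen(α, 2L|s₁|)`;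
* **`halfStepHypU_of_ineq`** — `HalfStepHypU S (Rl H Ŝ lev) (Rl H Ŝ (lev+1)) (unk L₀ 𝔏) L P m N N₁ T T′` for `lev < Ŝ` from `1 ≤ t`, `T′ + t ≤ T`,
  `1 ≤ H` and the single inequality
  `max (BwC·‖Λ/b_{j₀}‖·p^{⌊(t−1)/2⌋}·p^{condExp p (2N+1) t}) (BwC/(p^m√p)^{(2N+1)t}) < DC/(4·DC²·(1 + #U·P·MhC)·(∏H(α))³)^{2^{n+1}}`
  at every odd `|s₁| ≤ 2N₁−1` and order `|τ| + t ≤ T`.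

WHAT THIS IS NOT: the inequality (record); no crux moves.

References: Yu. V. Nesterenko, LNM 1819 (2003) §4.3; K. Yu, Compositio 74 (1990) Lemma 2.5.
-/

noncomputable section

open NormedSpace Finset Polynomial
open Literature.NumberTheory.Transcendental
open Literature.NumberTheory.Transcendental.PadicCW77 (condExp)
open Literature.NumberTheory.Transcendental.CW77.Setup (Tau tauNorm)
open scoped Nat

namespace Summit.ABC.StewartYu

namespace G3Setup

variable {p : ℕ} [Fact p.Prime] (S : G3Setup p)

/-- The clearing denominator of the half-point class-sum terms: `ν(H)^{t₀} · |b_{j₀}|^{|t|} · monDen(α, 2L|s₁|)`. [folklore] -/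
def DC (L : Fin S.n → ℕ) (H : ℕ) (s₁ : ℤ) (τ : Tau S.n) : ℕ :=
  (Nat.lcmUpto H) ^ τ.1 * (S.b S.j₀).natAbs ^ (∑ k, τ.2 k) * MonomialDen.monDen S.α (S.halfE L s₁)

/-- The size of the half-point class-sum terms: `2^{t₀} · M0C(lev+1) · XbC^{|t|} · monDen(α, 2L|s₁|)`. [folklore] -/
def MhC (L : Fin S.n → ℕ) (L₀ H Sh lev : ℕ) (s₁ : ℤ) (τ : Tau S.n) : ℝ :=
  (2 : ℝ) ^ τ.1 * (M0C L₀ H Sh (lev + 1) s₁ τ.1 : ℝ) * (S.XbC L : ℝ) ^ (∑ k, τ.2 k) * (MonomialDen.monDen S.α (S.halfE L s₁) : ℝ)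

/-- The defining bound of `M0C`: the real size expression is `≤ M0C` for every `ℓ₀ ≤ L₀`. [folklore] -/
theorem M0C_spec {H : ℕ} (_hH : 1 ≤ H) (L₀ Sh lev : ℕ) (i : ℕ × (Fin S.n → ℤ)) (hi1 : i.1 ≤ L₀) (x : ℤ) (t₀ : ℕ) :
    (2 : ℝ) ^ ((Sh - lev) * t₀) * ((Nat.lcmUpto H : ℝ) ^ t₀ *
      (Real.exp (H / Real.exp 1) * (Real.exp 1 * (1 + |((2 ^ (Sh - lev) * x : ℤ) : ℝ)| / H)) ^ i.1)) ≤ M0C L₀ H Sh lev x t₀ := by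
  unfold M0C
  refine le_trans ?_ (Int.le_ceil _)
  have hbase : (1 : ℝ) ≤ Real.exp 1 * (1 + |((2 ^ (Sh - lev) * x : ℤ) : ℝ)| / H) := by
    have h1 : (1 : ℝ) ≤ Real.exp 1 := Real.one_le_exp zero_le_one
    have h2 : (1 : ℝ) ≤ 1 + |((2 ^ (Sh - lev) * x : ℤ) : ℝ)| / H := by
      have : (0 : ℝ) ≤ |((2 ^ (Sh - lev) * x : ℤ) : ℝ)| / H := by positivity
      linarith
    nlinarith
  have hpow : (Real.exp 1 * (1 + |((2 ^ (Sh - lev) * x : ℤ) : ℝ)| / H)) ^ i.1 ≤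
      (Real.exp 1 * (1 + |((2 ^ (Sh - lev) * x : ℤ) : ℝ)| / H)) ^ L₀ := pow_le_pow_right₀ hbase hi1
  exact mul_le_mul_of_nonneg_left (mul_le_mul_of_nonneg_left (mul_le_mul_of_nonneg_left hpow (by positivity)) (by positivity))
    (by positivity)

/-- **`HalfStepHypU` from one inequality.** [cite: Nesterenko2003, §4.3; shape only] -/
theorem halfStepHypU_of_ineq {H Sh lev : ℕ} (hH : 1 ≤ H) (hlev : lev < Sh) (L₀ m : ℕ) (𝔏 : Finset (Fin S.n → ℤ)) (L : Fin S.n → ℕ)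
    (P : ℤ) {N N₁ T T' t : ℕ} (ht : 1 ≤ t) (hT : T' + t ≤ T)
    (hineq : ∀ s₁ : ℤ, Odd s₁ → |s₁| ≤ (2 * N₁ - 1 : ℤ) → ∀ τ : Tau S.n, tauNorm τ + t ≤ T →
      max (BwC (p := p) L₀ H m * ‖S.Λ / (S.b S.j₀ : ℚ_[p])‖ * (p : ℝ) ^ ((t - 1) / 2) * (p : ℝ) ^ condExp p (2 * N + 1) t)
        (BwC (p := p) L₀ H m / ((p : ℝ) ^ m * Real.sqrt p) ^ ((2 * N + 1) * t)) <
      (S.DC L H s₁ τ : ℝ) / (4 * (S.DC L H s₁ τ : ℝ) ^ 2 * (1 + ((S.unk L₀ 𝔏).card : ℝ) * P * S.MhC L L₀ H Sh lev s₁ τ) *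
        CW77.heightProd S.α ^ 3) ^ (2 ^ (S.n + 1))) :
    S.HalfStepHypU (S.Rl H Sh lev) (S.Rl H Sh (lev + 1)) (S.unk L₀ 𝔏) L P m N N₁ T T' := by
  refine ⟨t, BwC (p := p) L₀ H m, fun t₀ => (2 : ℚ) ^ t₀, fun s₁ τ => S.DC L H s₁ τ, fun s₁ τ => S.MhC L L₀ H Sh lev s₁ τ,
    ht, hT, ?_, S.hBw_closed L₀ H Sh lev m 𝔏, fun t₀ => pow_ne_zero _ two_ne_zero, ?_, ?_, ?_, ?_, ?_, hineq⟩
  · unfold BwC; exact mul_nonneg (sum_nonneg fun _ _ => by positivity) (by positivity)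
  · intro i _ t₀ s₁
    exact S.hasse_Rl_half (H := H) hlev i t₀ s₁
  · intro s₁ τ
    unfold DC
    exact one_le_mul (one_le_mul (Nat.one_le_pow _ _ (Nat.lcmUpto_pos H)) (Nat.one_le_pow _ _ (Int.natAbs_pos.mpr S.bj₀_ne)))
      (MonomialDen.one_le_monDen _ S.α_ne _)
  · intro s₁ τ
    unfold MhC
    have hM : (0 : ℝ) ≤ M0C L₀ H Sh (lev + 1) s₁ τ.1 := by
      have h0 : (0 : ℤ) ≤ M0C L₀ H Sh (lev + 1) s₁ τ.1 := by unfold M0C; exact Int.ceil_nonneg (by positivity)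
      exact_mod_cast h0
    have hX : (0 : ℝ) ≤ S.XbC L := by
      have h0 : (0 : ℤ) ≤ S.XbC L := by
        unfold XbC
        exact mul_nonneg (by norm_num) (mul_nonneg (sum_nonneg fun j _ => abs_nonneg _) (sum_nonneg fun j _ => by positivity))
      exact_mod_cast h0
    positivity
  · intro s₁ τ i hi w hw
    have hi1 : i.1 ≤ L₀ := by
      unfold unk at hi; have := (mem_product.mp hi).1; rw [mem_range] at this; omega
    have hM := S.M0C_spec (p := p) hH L₀ Sh (lev + 1) i hi1 s₁ τ.1
    exact (S.htermW_clear hH hlev i hw s₁ τ hM (S.hXb_closed L w hw)).1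
  · intro s₁ τ i hi w hw
    have hi1 : i.1 ≤ L₀ := by
      unfold unk at hi; have := (mem_product.mp hi).1; rw [mem_range] at this; omega
    have hM := S.M0C_spec (p := p) hH L₀ Sh (lev + 1) i hi1 s₁ τ.1
    have h := (S.htermW_clear hH hlev i hw s₁ τ hM (S.hXb_closed L w hw)).2
    unfold MhC
    exact h

end G3Setup

end Summit.ABC.StewartYu

end
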